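import Summits.CriticalPhenomena.CardyFormulaZ2.Theorems.CardyComplexConeParafermionToSLESixFamiliesDiamondTurnCountEscapePath
import Summits.CriticalPhenomena.CardyFormulaZ2.Theorems.CardyComplexConeParafermionToSLESixFamiliesDiamondDartPhaseLocal
import HarnessLib

/-!
# The winding of the exploration at the first dart of the wired arc is configuration-independent
# (line `potential-darboux-picard-diamond`, S1p `stub_boundaryDartPhase`, part 5)

Crux `ParafermionToSLESixFamilies` (stmt-CriticalPhenomena-11389), line `potential-darboux-picard-diamond`, stub
`stub_boundaryDartPhase` (S1p). The wired companion of S1t's `turnCount_touchSite`: at the first of the three consecutive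
`A`-corner darts `(x, k + 2)` of a tip cell of the wired arc along side `k` (`x ∈ A` one layer inside, `x + u_{k+3}`,
`x + u_k ∈ A` on the outer layer) the exploration escapes by the WIRED PREFIX `x → x + u_k → x + 2u_k → ⋯` (straight out along
the row of `x` to the far column, down to the far corner) followed by a route `Q` and a gadget. The escape leaves `x` along
its `(j+2)`-nd edge, so the corners it uses at `x` and at the `A`-site `x + u_k` — `(x, k+3)`, `(x + u_k, k+2)`,
`(x + u_k, k+3)` — have non-inner faces (their common far corner `x + u_k + u_{k+3}` is off the diamond) although their
vertices are not forbidden: the corner-level escape theorem of `gadget_dataC` is what applies. Bookkeeping: the wired prefix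
is S1t's prefix `prefixPath k (x + u_{k+1}) K` of the inward neighbour with its first step removed, so `splice_escapeData`
is reused verbatim and the signed turning is again `-1 + walkTurns (k + 1) Q` (`turnCount_wiredSite`, registered): along a
straight side the wired first darts carry the SAME configuration-independent winding as the free touch darts escaping through
the same route.
-/

noncomputable section

namespace Summit.CriticalPhenomena.CardyFormulaZ2.Cruxes.ParafermionToSLESixFamilies.PotentialDarbouxPicardDiamond

open Set Metric Complex
open Literature.Probability Literature.Probability.LatticeModels Literature.Probability.Percolation
open Literature.Probability.LatticeModels.DiscreteDobrushin
open Literature.Probability.RandomPlanarGeometry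

/-- One lattice step has frame `ℓ¹`-length one. -/
theorem l1_frame_step (k m : Fin 4) (v : Site 2) :
    |xiC k (v + cornerUnit m) - xiC k v| + |upC k (v + cornerUnit m) - upC k v| = 1 := by
  fin_cases k <;> fin_cases m <;> simp [xiC, upC, cornerUnit]

/-- The corner walk entered one index earlier starts with one extra corner at the first vertex. -/
theorem cornerWalk_pred_entry (x : Site 2) (k : Fin 4) (W : List (Fin 4)) :
    cornerWalk x (k + 1) (k :: W) = (x, k + 1) :: cornerWalk x (k + 2) (k :: W) := by
  have h2 : ∀ k : Fin 4, (k + 3 - (k + 1)).val = 2 ∧ (k + 3 - (k + 2)).val = 1 ∧ k + 1 + 1 = k + 2 := by decide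
  rw [cornerWalk_cons, cornerWalk_cons, (h2 k).1, (h2 k).2.1]
  simp only [fanL, (h2 k).2.2, List.cons_append]

/-- The first four corners of the wired walk: `(x, k+2), (x, k+3), (x + u_k, k+2), (x + u_k, k+3)`. -/
theorem cornerWalk_wired_eq (x : Site 2) (k : Fin 4) (R : List (Fin 4)) :
    cornerWalk x (k + 2) (k :: k :: R) = (x, k + 2) :: (x, k + 3) :: (x + cornerUnit k, k + 2) :: (x + cornerUnit k, k + 3) ::
      cornerWalk (x + cornerUnit k + cornerUnit k) (k + 2) R := by
  have h1 : ∀ k : Fin 4, (k + 3 - (k + 2)).val = 1 ∧ k + 2 + 1 = k + 3 := by decide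
  rw [cornerWalk_cons, cornerWalk_cons, (h1 k).1]
  simp only [fanL, (h1 k).2, List.cons_append, List.nil_append]

/-- **The winding at the first dart of the wired arc** (registered helper of `stub_boundaryDartPhase`). See the module
docstring. -/
theorem turnCount_wiredSite : ∀ (D : DobrushinDomain) (c : ℂ) (α β : ℝ), D.carrier = {z | |((z - c) * exp (-(Real.pi / 4 : ℝ) * I)).re| < α ∧ |((z - c) * exp (-(Real.pi / 4 : ℝ) * I)).im| < β} → ∀ (k : Fin 4) (E : DiscreteDobrushin) (hE : E.IsZdAdmissible) (δ : ℝ), 0 < δ → E.Ω = D.carrier → E.δ = δ → ∀ (ι : Site 2 → ℤ), (∀ v : Site 2, meshPoint δ v ∉ D.carrier → ι v = 0) → (∀ v : Site 2, meshPoint δ v ∈ D.carrier → ι v = 1) → ∀ (K₀ : ℕ), (∀ v : Site 2, meshPoint δ v ∈ D.carrier → |xiC k v| ≤ K₀ ∧ |upC k v| ≤ K₀) → (∀ v : Site 2, (xiC k v = 3 * K₀ + 10 ∨ xiC k v = -(3 * K₀ + 10) ∨ upC k v = 3 * K₀ + 10 ∨ upC k v = -(3 * K₀ + 10)) → meshPoint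 δ v ∉ D.carrier) → ∀ (ps : Site 2), meshPoint δ ps ∉ D.carrier → ∀ (gds : List (Fin 4)) (g : ℤ), gds ≠ [] → pathEnd ps gds = (startCorner hE).1 → (∀ v ∈ pathVerts ps gds, v = ps ∨ v = (startCorner hE).1 + cornerUnit (startCorner hE).2) → (∀ (u : Site 2) (j : Fin 4) (ds : List (Fin 4)) (d : Site 2 × Fin 4) (S : ℤ), 2 ≤ ds.length → pathEnd u ds = (startCorner hE).1 → lastDir ds = lastDir gds → (∀ d' ∈ (cornerWalk u j ds).tail, ¬ E.IsInnerFace (cFace d') ∨ d'.1 ∈ E.zdArcB) → (pathVerts u ds ++ [(startCorner hE).1]).Nodup → d ∈ cornerWalk u j ds → d.2 = j + 3 → (∀ p' : Site 2 × Fin 4, E.IsInnerFace (cFace p') → sideVal j (cpos p') ≤ S) → (∀ d' ∈ cornerWalk u j ds, sideVal j (cpos d') ≤ S) → sideVal j (cpos ((startCorner hE).1, (startCorner hE).2 + 3)) ≤ S → sideVal j (cpos d) = S → ∀ (ω : BondConfig (Site 2)) (t : ℕ), t < exitTime hE ω → cornerOrbit (E.bcBondConfig ω) (startCorner hE) t =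 (u, j) → turnCount (E.bcBondConfig ω) (startCorner hE) t = -4 - (walkTurns j ds + g)) → ∀ (Q : List (Fin 4)) (C : Site 2 → Prop), (∀ v : Site 2, C v → ι v = 0) → (∀ vs : Site 2, xiC k vs = 3 * K₀ + 10 → upC k vs = -(3 * K₀ + 10) → ∃ Qt : List (Fin 4), Q = (k + 2) :: Qt ∧ pathEnd vs Q = pathEnd ps gds ∧ lastDir Q = lastDir gds ∧ (∀ v ∈ pathVerts vs Q, C v ∨ v ∈ pathVerts ps gds) ∧ (pathVerts vs Q).Nodup ∧ pathEnd ps gds ∉ pathVerts vs Q ∧ (∀ b ∈ pathVerts vs Q, b = vs ∨ xiC k b - upC k b ≤ 2 * (3 * K₀ + 10) - 1)) → ∀ (x : Site 2), meshPoint δ x ∈ D.carrier → meshPoint δ (x + cornerUnit (k + 1)) ∈ D.carrier → (∀ v : Site 2, xiC k x - upC k x + 2 ≤ xiC k v - upC k v → meshPoint δ v ∉ D.carrier) → (∀ v : Site 2, |xiC k v - xiC k x| + |upC k v - upC k x| ≤ 3 → v ∉ E.zdArcB) → ((∀ v : Site 2, C v → SafeVertex k (x + cornerUnit (k + 1)) (3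 * K₀ + 10) ι v) ∧ (∀ v ∈ pathVerts ps gds, SafeVertex k (x + cornerUnit (k + 1)) (3 * K₀ + 10) ι v)) → ∀ (ω : BondConfig (Site 2)) (t : ℕ), t < exitTime hE ω → cornerOrbit (E.bcBondConfig ω) (startCorner hE) t = (x, k + 2) → turnCount (E.bcBondConfig ω) (startCorner hE) t = -4 - ((-1 + walkTurns (k + 1) Q) + g) := by
  intro D c α β hcar k E hE δ hδ hEΩ hEδ ι hι0 hι1 K₀ hK₀in hK₀out ps hpsout gds g hgds hgend hgV hHT Q C hC0 hQdata x hxin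
    huin houtX hnoB hsafe ω t ht horb
  have hsc := isStartCorner_startCorner hE
  set x₀ := (startCorner hE).1 with hx₀
  set k₀ := (startCorner hE).2 with hk₀
  set K : ℤ := 3 * K₀ + 10 with hK
  set u' := x + cornerUnit (k + 1) with hu'
  have hx0in : meshPoint δ x₀ ∈ D.carrier := by
    have := mem_of_mem_zdBoundary (E.zdArcA_subset_zdBoundary hsc.mem_zdArcA); rwa [hEΩ, hEδ] at this
  -- outside sites have no inner face
  have hout0 : ∀ v : Site 2, ι v = 0 → ∀ i : Fin 4, ¬ E.IsInnerFace (faceAt v i) := by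
    intro v hv
    have hv' : meshPoint E.δ v ∉ E.Ω := by
      rw [hEΩ, hEδ]; intro h; have := hι1 v h; omega
    exact forall_not_isInnerFace_of_not_mem hv'
  -- the inward neighbour and the far size
  have hu'S : u' + cornerUnit (k + 3) = x := by
    rw [hu', add_assoc, show k + 3 = k + 1 + 2 by abel, cornerUnit_add_two, add_neg_cancel, add_zero]
  have hxiu : xiC k u' = xiC k x := by rw [hu']; simp
  have hupu : upC k u' = upC k x + 1 := by rw [hu']; simp
  obtain ⟨hu1, hu2⟩ := hK₀in x hxin
  rw [abs_le] at hu1 hu2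
  have hK1 : xiC k u' + 2 ≤ K := by omega
  have hK2 : 1 ≤ upC k u' - 1 + K := by omega
  have hvs1 := xiC_pathEnd_prefixPath k u' K hK1
  have hvs2 := upC_pathEnd_prefixPath k u' K (by omega)
  set vs := pathEnd u' (prefixPath k u' K) with hvs
  obtain ⟨Qt, hQ, hend, hlast, hmem, hnd, hnew, hreg⟩ := hQdata vs hvs1 hvs2
  subst hQ
  -- the inputs of the splicing lemma
  have hιu : ι u' = 1 := hι1 u' huin
  have hιb : ι (u' + cornerUnit (k + 3)) = 1 := by rw [hu'S]; exact hι1 x hxin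
  have hιE : ∀ v : Site 2, upC k v = upC k u' - 1 → xiC k u' + 2 ≤ xiC k v → ι v = 0 :=
    fun v h1 h2 => hι0 v (houtX v (by omega))
  have hιS : ∀ v : Site 2, xiC k v = K → ι v = 0 := fun v h => hι0 v (hK₀out v (Or.inl h))
  have hsafe' : ∀ b ∈ pathVerts vs ((k + 2) :: Qt), SafeVertex k u' K ι b :=
    fun b hb => (hmem b hb).elim (hsafe.1 b) (hsafe.2 b)
  have hxend : pathEnd vs ((k + 2) :: Qt) = x₀ := hend.trans hgend
  have hx' : pathEnd vs ((k + 2) :: Qt) ∉ pathVerts vs ((k + 2) :: Qt) := by rw [hend]; exact hnew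
  have hιx : ι (pathEnd vs ((k + 2) :: Qt)) = 1 := by rw [hxend]; exact hι1 _ hx0in
  have hxbox : ¬ (xiC k u' ≤ xiC k (pathEnd vs ((k + 2) :: Qt)) ∧ xiC k (pathEnd vs ((k + 2) :: Qt)) ≤ xiC k u' + 1 ∧
      upC k u' - 1 ≤ upC k (pathEnd vs ((k + 2) :: Qt)) ∧ upC k (pathEnd vs ((k + 2) :: Qt)) ≤ upC k u') := by
    rw [hxend]
    intro hbox
    -- the `B`-end of the start edge would sit in the block of `x`
    have hstep := l1_frame_step k k₀ x₀
    have h1 : |xiC k x₀ - xiC k x| ≤ 1 := by rw [abs_le]; omega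
    have h2 : |upC k x₀ - upC k x| ≤ 1 := by rw [abs_le]; omega
    have t1 := abs_sub_le (xiC k (x₀ + cornerUnit k₀)) (xiC k x₀) (xiC k x)
    have t2 := abs_sub_le (upC k (x₀ + cornerUnit k₀)) (upC k x₀) (upC k x)
    exact hnoB (x₀ + cornerUnit k₀) (by linarith) hsc.mem_zdArcB
  obtain ⟨-, -, hpe, hld, hnodup, htail, hdmem, hdval, hdom, hwt⟩ :=
    splice_escapeData k u' K ι Qt hK1 hK2 hιu hιb hιE hιS hsafe' hnd hx' hιx hxbox hreg
  -- the wired path: S1t's path of `u'` with its first step removed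
  set R : List (Fin 4) := (List.replicate (K - xiC k u' - 2).toNat k ++ List.replicate (upC k u' - 1 + K).toNat (k + 3)) ++
    (k + 2) :: Qt with hR
  set W : List (Fin 4) := k :: k :: R with hW
  have hP : prefixPath k u' K ++ (k + 2) :: Qt = (k + 3) :: W := by
    rw [prefixPath_eq_cons]; simp only [hW, hR, List.cons_append, List.append_assoc]
  rw [hP] at hpe hld hnodup htail hdmem hdom hwt
  set z := x + cornerUnit k with hz
  set w := x + cornerUnit k + cornerUnit k with hw
  have hcw := cornerWalk_wired_eq x k R
  rw [← hW] at hcw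
  -- the corner walk of `u'` is two corners longer
  have hcw' : cornerWalk u' (k + 2) ((k + 3) :: W) = (u', k + 2) :: (x, k + 1) :: cornerWalk x (k + 2) W := by
    have h0 : ∀ k : Fin 4, (k + 3 + 3 - (k + 2)).val = 0 ∧ k + 3 + 2 = k + 1 := by decide
    rw [cornerWalk_cons, (h0 k).1, (h0 k).2, hu'S]
    simp only [fanL, List.singleton_append, hW, cornerWalk_pred_entry]
  -- vertices of the wired path
  have hPV : pathVerts u' ((k + 3) :: W) = u' :: pathVerts x W := by rw [pathVerts_cons, hu'S]
  have hWV : pathVerts x W = x :: z :: pathVerts w R := by simp only [hW, pathVerts_cons, hz, hw]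
  rw [hPV] at hnodup htail
  rw [List.cons_append, List.nodup_cons] at hnodup
  obtain ⟨-, hnodupW⟩ := hnodup
  rw [List.tail_cons] at htail
  have hndW : (pathVerts x W).Nodup := (List.nodup_append.1 hnodupW).1
  rw [hWV] at hndW
  have hxR : x ∉ pathVerts w R := fun h => (List.nodup_cons.1 hndW).1 (List.mem_cons_of_mem _ h)
  have hzR : z ∉ pathVerts w R := (List.nodup_cons.1 (List.nodup_cons.1 hndW).2).1
  -- the far corner of the three special faces is off the diamond
  have hfar : meshPoint E.δ (x + cornerUnit k + cornerUnit (k + 3)) ∉ E.Ω := by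
    rw [hEΩ, hEδ]; apply houtX; simp; omega
  -- corner-level forbiddenness of the wired walk
  have hforb : ∀ d' ∈ (cornerWalk x (k + 2) W).tail, ¬ E.IsInnerFace (cFace d') ∨ d'.1 ∈ E.zdArcB := by
    intro d' hd'
    rw [hcw, List.tail_cons, List.mem_cons, List.mem_cons, List.mem_cons] at hd'
    rcases hd' with rfl | rfl | rfl | hd'
    · left; change ¬ E.IsInnerFace (faceAt x (k + 3))
      rw [faceAt_wired₁]; exact not_isInnerFace_of_corner_not_mem (isCorner_faceAt _ _) hfar
    · left; change ¬ E.IsInnerFace (faceAt (x + cornerUnit k) (k + 2))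
      rw [faceAt_wired₂]; exact not_isInnerFace_of_corner_not_mem (isCorner_faceAt _ _) hfar
    · left; change ¬ E.IsInnerFace (faceAt (x + cornerUnit k) (k + 3))
      rw [faceAt_wired₃]; exact not_isInnerFace_of_corner_not_mem (isCorner_faceAt _ _) hfar
    · have hv : d'.1 ∈ pathVerts w R := fst_mem_pathVerts hd'
      have hvW : d'.1 ∈ pathVerts x W := by rw [hWV]; exact List.mem_cons_of_mem _ (List.mem_cons_of_mem _ hv)
      rcases htail d'.1 hvW with h | h | h0 | hQv
      · exact absurd hv (by rw [hu'S] at h; rw [h]; exact hxR)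
      · exact absurd hv (by rw [hu'S] at h; rw [h]; exact hzR)
      · exact Or.inl (hout0 _ h0 d'.2)
      · rcases hmem _ hQv with hC | hg
        · exact Or.inl (hout0 _ (hC0 _ hC) d'.2)
        · rcases hgV _ hg with h | h
          · exact Or.inl (hout0 _ (h ▸ hι0 ps hpsout) d'.2)
          · exact Or.inr (h ▸ hsc.mem_zdArcB)
  -- the side functional on inner faces and at the start corner
  have hbound : ∀ v : Site 2, meshPoint δ v ∈ D.carrier → ∀ m : Fin 4, sideVal (k + 2) (cpos (v, m)) ≤ 2 * K - 1 + cK k := by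
    intro v hv m
    obtain ⟨h1, h2⟩ := hK₀in v hv
    rw [abs_le] at h1 h2
    have := sideVal_cpos_le k v m
    omega
  have hI : ∀ p' : Site 2 × Fin 4, E.IsInnerFace (cFace p') → sideVal (k + 2) (cpos p') ≤ 2 * K - 1 + cK k := by
    rintro ⟨v, m⟩ hp'
    have hin : meshPoint δ v ∈ D.carrier := by
      have := corner_mem_of_isInnerFace hp' (isCorner_cFace (v, m)); rwa [hEΩ, hEδ] at this
    exact hbound v hin m
  -- the far corner is a corner of the wired walk
  have hdmem' : (vs, k + 1) ∈ cornerWalk x (k + 2) W := by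
    rw [hcw', List.mem_cons, List.mem_cons] at hdmem
    rcases hdmem with h | h | h
    · exact absurd (congrArg Prod.snd h) (by simp)
    · exfalso
      have := congrArg (fun p => xiC k p.1) h
      simp only at this
      rw [hvs1] at this; omega
    · exact h
  have hdom' : ∀ d' ∈ cornerWalk x (k + 2) W, sideVal (k + 2) (cpos d') ≤ 2 * K - 1 + cK k :=
    fun d' hd' => hdom d' (by rw [hcw']; exact List.mem_cons_of_mem _ (List.mem_cons_of_mem _ hd'))
  -- end vertex, last direction, no repeats
  have hpeW : pathEnd x W = x₀ := by
    rw [pathEnd_cons, hu'S] at hpe; exact hpe.trans hxend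
  have hldW : lastDir W = lastDir gds := by
    rw [hW, lastDir_cons_cons] at hld; rw [hW]; exact hld.trans hlast
  have hnodupW' : (pathVerts x W ++ [x₀]).Nodup := by rw [← hxend]; exact hnodupW
  -- the signed turning of the wired path is that of S1t's path
  have hwtW : walkTurns (k + 2) W = -1 + walkTurns (k + 1) ((k + 2) :: Qt) := by
    have c : ∀ k : Fin 4, ((k + 3 + 3 - (k + 2)).val : ℕ) = 0 ∧ k + 3 + 2 = k + 1 ∧ ((k + 3 - (k + 1)).val : ℕ) = 2 ∧
        ((k + 3 - (k + 2)).val : ℕ) = 1 := by decide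
    rw [walkTurns, (c k).1, (c k).2.1, hW, walkTurns, (c k).2.2.1] at hwt
    rw [hW, walkTurns, (c k).2.2.2]
    push_cast at hwt ⊢
    linarith
  have key := hHT x (k + 2) W (vs, k + 1) (2 * K - 1 + cK k) (by simp [hW]) hpeW hldW hforb hnodupW' hdmem'
    (fin4_add_two_add_three k).symm hI hdom' (hbound _ hx0in _) hdval ω t ht horb
  rw [key, hwtW]

end Summit.CriticalPhenomena.CardyFormulaZ2.Cruxes.ParafermionToSLESixFamilies.PotentialDarbouxPicardDiamond

end
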